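import Summits.QuantumFields.QCD.Theorems.QuarksAsStableActionStableActionBridgeFockLiftPosDef
import Literature.MathematicalPhysics.QuantumLattice.FermionGammaDerivative
import HarnessLib

/-!
# Stub `stub_Gamma_conj_dGamma` of line `pin-the-infimum` (crux `RobustYangMillsHandover`, 8892)

E2, layer W2-5 of the fermionic-insertion bricks in Lüscher's transfer-matrix representation of
the QCD torus functional. A quark bilinear inserted at a time slice becomes the Fock operator
`dΓ(Z) + c·1` sitting between two transfer factors `Γ(N)`; undressing the temporal transporters
and passing to Smit's vocabulary conjugates it by `Γ(S)` for an INVERTIBLE (not unitary)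
one-particle matrix `S`. The second quantisation `Γ = Gamma` (matrix of minors on the
Jordan–Wigner Fock space `Finset ι → ℂ`, `Literature/MathematicalPhysics/QuantumLattice/FermionGammaFunctor`)
acts on its differential `dΓ = dGamma` (`dΓ(Y) = Σᵢⱼ Yᵢⱼ c†ᵢ cⱼ`, `FermionQuasiFree`) by the ADJOINT
action on the one-particle matrix:

  `Γ(g) dΓ(Y) Γ(g⁻¹) = dΓ(g Y g⁻¹)`,  equivalently  `Γ(g) dΓ(Y) = dΓ(g Y g⁻¹) Γ(g)`   (`det g` a unit).

Conjunct 3 records that `dΓ(Y)` is even under the fermion parity `(−1)^N̂ = diagonal((−1)^{#s})`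
(it preserves the particle number), which is what cyclicity of the supertrace needs; conjunct 4
re-exports the bridge `fockLift = Gamma` between the two copies of the functor in the tree
(`Summit.QuantumFields.QCD.Cruxes.StableActionBridge.Sketch.fockLift_eq_Gamma`).

## Proof

Covariance (`StubGammaConjDGamma.Gamma_mul_dGamma_mul_Gamma_inv`): DIFFERENTIATE the functor identity.
For real `s` the one-particle path `h(s) = g (1 + sY) g⁻¹` equals `1 + s (g Y g⁻¹)` when `g g⁻¹ = 1`, so by
the tree's `hasDerivAt_Gamma_one_add_smul_apply` (`d/ds|₀ Γ(1 + sZ) = dΓ(Z)`, entrywise) every entry of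
`Γ(h(s))` has derivative `⟨S| dΓ(g Y g⁻¹) |T⟩` at `s = 0`; on the other hand functoriality
`Γ(g (1 + sY) g⁻¹) = Γ(g (1 + sY)) Γ(g⁻¹)` (`Gamma_mul`) and `hasDerivAt_Gamma_mul_one_add_smul_apply`
(`d/ds|₀ Γ(g(1 + sY)) = Γ(g) dΓ(Y)`) give the derivative `⟨S| Γ(g) dΓ(Y) Γ(g⁻¹) |T⟩`; derivatives are
unique (`HasDerivAt.unique`). The intertwining form follows by right multiplication with `Γ(g)`
(`Gamma_inv_mul`). Parity: the fermion parity IS a value of the functor, `(−1)^N̂ = Γ(−1)`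
(`StubGammaConjDGamma.Gamma_neg_one`: the minors of `−1` are `(−1)^{#S} δ_{S,T}`), and `−1` is
invertible and central, so conjunct 3 is the intertwining form at `g = −1`. No matrix norm, no sign
bookkeeping beyond `det(−M) = (−1)^k det M`.

The tree already has the UNITARY special case `Γ(V)ᴴ dΓ(h) Γ(V) = dΓ(Vᴴ h V)`
(`Summit.HubbardSuperconductivity.…WidthHaldane.Gamma_conjTranspose_mul_dGamma_mul_Gamma`, via a unitary
logarithm and `e^{dΓ(K)} dΓ(h) e^{−dΓ(K)} = dΓ(e^{K} h e^{−K})`); the transfer-matrix application needs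
general invertible `g`, whence the derivative route here (not imported).

References: J. Dereziński, C. Gérard, *Mathematics of Quantization and Quantum Fields* (CUP 2013/2022),
§3.2.2 Prop. 3.23 (1) and §3.3.3 (`Γ(p)`, `dΓ(h)`; `Γ` is a homomorphism and `dΓ` its differential);
O. Bratteli, D. W. Robinson, *Operator Algebras and Quantum Statistical Mechanics 2*, §5.2.1
(`Γ(U) dΓ(A) Γ(U)* = dΓ(U A U*)`); J. Smit, *Introduction to Quantum Fields on a Lattice*, App. C
(transfer operator for fermions).
-/

open Matrix Literature.MathematicalPhysics.QuantumLattice Literature.MathematicalPhysics.QuantumFieldTheory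

namespace Summit.QuantumFields.QCD.Cruxes.RobustYangMillsHandover.PinTheInfimum

namespace StubGammaConjDGamma

variable {ι : Type*} [LinearOrder ι] [Fintype ι]

/-- **`d/ds|₀ Γ(g (1 + sY) h) = Γ(g) dΓ(Y) Γ(h)`** entrywise, for arbitrary one-body matrices
`g, Y, h`: functoriality `Γ(g(1 + sY)h) = Γ(g(1 + sY)) Γ(h)` and the tree's
`hasDerivAt_Gamma_mul_one_add_smul_apply` (`d/ds|₀ Γ(g(1 + sY)) = Γ(g) dΓ(Y)`), summed over the
intermediate occupation basis. Dereziński–Gérard Prop. 3.23 (1). [folklore] -/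
theorem hasDerivAt_Gamma_mul_one_add_smul_mul_apply (g Y h : Matrix ι ι ℂ) (S T : Finset ι) :
    HasDerivAt (fun s : ℝ => Gamma (g * (1 + (s : ℂ) • Y) * h) S T)
      ((Gamma g * dGamma Y * Gamma h) S T) 0 := by
  have hfun : (fun s : ℝ => Gamma (g * (1 + (s : ℂ) • Y) * h) S T) =
      fun s : ℝ => ∑ U, Gamma (g * (1 + (s : ℂ) • Y)) S U * Gamma h U T := by
    funext s
    rw [Gamma_mul, Matrix.mul_apply]
  rw [hfun, Matrix.mul_apply]
  exact HasDerivAt.fun_sum fun U _ => (hasDerivAt_Gamma_mul_one_add_smul_apply g Y S U).mul_const _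

/-- **Covariance of `dΓ` under `Γ` of an invertible one-particle matrix**:
`Γ(g) dΓ(Y) Γ(g⁻¹) = dΓ(g Y g⁻¹)` whenever `det g` is a unit. Both sides are the derivative at
`s = 0` of the same entry of `Γ(g (1 + sY) g⁻¹) = Γ(1 + s · gYg⁻¹)` (computed once through
`hasDerivAt_Gamma_mul_one_add_smul_mul_apply` and once through `hasDerivAt_Gamma_one_add_smul_apply`),
and derivatives are unique. Dereziński–Gérard Prop. 3.23 (1); Bratteli–Robinson II §5.2.1
(`Γ(U) dΓ(A) Γ(U)* = dΓ(UAU*)` for unitary `U`). [folklore] -/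
theorem Gamma_mul_dGamma_mul_Gamma_inv {g : Matrix ι ι ℂ} (hg : IsUnit g.det) (Y : Matrix ι ι ℂ) :
    Gamma g * dGamma Y * Gamma g⁻¹ = dGamma (g * Y * g⁻¹) := by
  ext S T
  refine (hasDerivAt_Gamma_mul_one_add_smul_mul_apply g Y g⁻¹ S T).unique ?_
  have hfun : (fun s : ℝ => Gamma (g * (1 + (s : ℂ) • Y) * g⁻¹) S T) =
      fun s : ℝ => Gamma (1 + (s : ℂ) • (g * Y * g⁻¹)) S T := by
    funext s
    rw [Matrix.mul_add, Matrix.mul_one, Matrix.add_mul, Matrix.mul_nonsing_inv _ hg,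
      Matrix.mul_smul, Matrix.smul_mul]
  rw [hfun]
  exact hasDerivAt_Gamma_one_add_smul_apply (g * Y * g⁻¹) S T

/-- **Intertwining form of the covariance**: `Γ(g) dΓ(Y) = dΓ(g Y g⁻¹) Γ(g)` for `det g` a unit
(right-multiply `Gamma_mul_dGamma_mul_Gamma_inv` by `Γ(g)` and use `Γ(g⁻¹) Γ(g) = 1`).
Dereziński–Gérard Prop. 3.23 (1). [folklore] -/
theorem Gamma_mul_dGamma {g : Matrix ι ι ℂ} (hg : IsUnit g.det) (Y : Matrix ι ι ℂ) :
    Gamma g * dGamma Y = dGamma (g * Y * g⁻¹) * Gamma g := by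
  rw [← Gamma_mul_dGamma_mul_Gamma_inv hg Y, Matrix.mul_assoc, Gamma_inv_mul hg, Matrix.mul_one]

/-- **The fermion parity is `Γ(−1)`**: `Γ(−1) = diagonal (S ↦ (−1)^{#S}) = (−1)^N̂`, since the
minor of `−1` with rows `S` and columns `T` (`#S = #T = k`) is `(−1)^k` times that of `1`, i.e.
`(−1)^{#S} δ_{S,T}` (`Γ(1) = 1`). Dereziński–Gérard §3.3.3. [folklore] -/
theorem Gamma_neg_one :
    Gamma (-1 : Matrix ι ι ℂ) = Matrix.diagonal fun s : Finset ι => (-1 : ℂ) ^ s.card := by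
  ext S T
  by_cases hc : S.card = T.card
  · rw [Gamma_apply_of_card_eq (-1 : Matrix ι ι ℂ) rfl hc.symm,
      show (-1 : Matrix ι ι ℂ).submatrix (S.orderEmbOfFin rfl) (T.orderEmbOfFin hc.symm) =
          -((1 : Matrix ι ι ℂ).submatrix (S.orderEmbOfFin rfl) (T.orderEmbOfFin hc.symm)) from rfl,
      Matrix.det_neg, Fintype.card_fin, ← Gamma_apply_of_card_eq (1 : Matrix ι ι ℂ) rfl hc.symm,
      Gamma_one, Matrix.diagonal_apply, Matrix.one_apply, mul_ite, mul_one, mul_zero]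
  · rw [Gamma_apply_of_card_ne _ hc, Matrix.diagonal_apply, if_neg]
    rintro rfl
    exact hc rfl

/-- **`dΓ(Y)` is parity-even**: `(−1)^N̂ dΓ(Y) = dΓ(Y) (−1)^N̂` with `(−1)^N̂ = diagonal (S ↦ (−1)^{#S})`
— the intertwining form `Gamma_mul_dGamma` at the central unit `g = −1` (`(−1) Y (−1)⁻¹ = Y`),
read through `Gamma_neg_one`. Equivalently `dΓ(Y) = Σ Yᵢⱼ c†ᵢcⱼ` preserves the particle number.
Bratteli–Robinson II §5.2.1. [folklore] -/
theorem parity_mul_dGamma (Y : Matrix ι ι ℂ) :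
    Matrix.diagonal (fun s : Finset ι => (-1 : ℂ) ^ s.card) * dGamma Y =
      dGamma Y * Matrix.diagonal (fun s : Finset ι => (-1 : ℂ) ^ s.card) := by
  have hmul : (-1 : Matrix ι ι ℂ) * (-1) = 1 := by rw [neg_mul_neg, Matrix.one_mul]
  have hinv : (-1 : Matrix ι ι ℂ)⁻¹ = -1 := Matrix.inv_eq_right_inv hmul
  have hdet : IsUnit (-1 : Matrix ι ι ℂ).det := (Matrix.isUnit_iff_isUnit_det _).mp isUnit_one.neg
  have h := Gamma_mul_dGamma hdet Y
  rwa [hinv, neg_one_mul, mul_neg_one, neg_neg, Gamma_neg_one] at h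

end StubGammaConjDGamma

/-- **E2 W2-5: `Γ`-conjugation covariance and parity of `dΓ`** (registered stub signature verbatim).
For a finite linearly ordered mode set `ι` and one-particle matrices `g, Y` with `det g` a unit:
(1) `Γ(g) dΓ(Y) Γ(g⁻¹) = dΓ(g Y g⁻¹)` (second quantisation is a functor and `dΓ` its differential —
Dereziński–Gérard, *Mathematics of Quantization and Quantum Fields*, Prop. 3.23 (1); Bratteli–Robinson II
§5.2.1); (2) the intertwining form `Γ(g) dΓ(Y) = dΓ(g Y g⁻¹) Γ(g)`; (3) `dΓ(Y)` commutes with the fermion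
parity `diagonal (S ↦ (−1)^{#S}) = Γ(−1)`; (4) the bridge `fockLift g = Gamma g` between the two copies of
the functor in the tree (`StableActionBridge.Sketch.fockLift_eq_Gamma`). [folklore] -/
theorem stub_Gamma_conj_dGamma :
    ∀ (ι : Type) [LinearOrder ι] [Fintype ι] (g Y : Matrix ι ι ℂ), IsUnit g.det →
      Gamma g * dGamma Y * Gamma g⁻¹ = dGamma (g * Y * g⁻¹) ∧
      Gamma g * dGamma Y = dGamma (g * Y * g⁻¹) * Gamma g ∧
      Matrix.diagonal (fun s : Finset ι => (-1 : ℂ) ^ s.card) * dGamma Y =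
        dGamma Y * Matrix.diagonal (fun s : Finset ι => (-1 : ℂ) ^ s.card) ∧
      fockLift g = Gamma g := by
  intro ι _ _ g Y hg
  exact ⟨StubGammaConjDGamma.Gamma_mul_dGamma_mul_Gamma_inv hg Y,
    StubGammaConjDGamma.Gamma_mul_dGamma hg Y, StubGammaConjDGamma.parity_mul_dGamma Y,
    Summit.QuantumFields.QCD.Cruxes.StableActionBridge.Sketch.fockLift_eq_Gamma ι g⟩

end Summit.QuantumFields.QCD.Cruxes.RobustYangMillsHandover.PinTheInfimum
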